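import Summits.SmoothPoincare4.SmoothPoincare4.Theorems.AcyclicBisectionRigidity.Negative.DoubleSector
import Literature.Topology.FourManifolds.CorkDecompositionSplitting
import Literature.Topology.FourManifolds.GluingProofs

/-!
# `AcyclicBisectionRigidity` — negative-side support: the round-2 Transfer `DoubleReduction` is the crux in a costume

Support lemmas for the crux
`Summit.SmoothPoincare4.SmoothPoincare4.Theses.ConvexBisection.AcyclicBisectionRigidity`
(stmt-SmoothPoincare4-10507), from the standing disprover's work file
`Cruxes/AcyclicBisectionRigidity/Disproof.lean` §13a–b (gen 5; every statement inline).

The round-2 crux card `achiral-relator-reduction` transfers the crux to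
`C⁺ = DoubleReduction`: "every acyclically common-contact Stein-bisected homotopy 4-sphere is a
double `D(W) = W ∪_id W` of SOME compact contractible Stein domain `W`", and composes
`C⁺ ∧ (crux 4) ⇒ crux`. Here:

* `isDouble_closedBall_of_crux` — the crux IMPLIES `C⁺`, with `W = 𝔻⁴`: a standard `M ≅ S⁴` is
  the double of the closed ball (`isDouble_sphere_holds 3` transported along `M ≅ S⁴` by
  `IsBoundaryGluing.diffeomorph_comp`), and `𝔻⁴` is a compact contractible Stein domain;
* `isDouble_closedBall_of_spc4` — hence `C⁺` is SPC4-implied (unrefutable short of an exotic `S⁴`);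
* `crux_iff_doubleReduction_of_crux4` — and modulo crux 4 (`ContractibleTwistedDoubleStandard`,
  stmt-SmoothPoincare4-3546, via the sibling's `double_standard_of_crux`) `C⁺` is EQUIVALENT to the
  crux: as a statement the Transfer gains nothing; the card's content is its method `T`
  (monotone achiral reducibility), refuted at `k = 5` in the Disproof §13c;
* `complementRecognition` — the typed first lemma of the sibling round-2 card
  `exchange-recognition` ("`M` and `S⁴` both the gluing `W₁ ∪_φ W₂` ⇒ `M ≅ S⁴`") is the tree's
  uniqueness of gluings once `φ` is typed as a diffeomorphism.
-/

noncomputable section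

-- The namespace is prescribed by the crux protocol (`Summit.<P>.<Sub>.Theorems.<Crux>.Negative`
-- with `P = Sub = SmoothPoincare4`), hence the duplicated component.
set_option linter.dupNamespace false

open scoped Manifold ContDiff Topology ContinuousMap
open Set Function Literature.Geometry.Symplectic Literature.AlgebraicTopology.SingularHomology
  Literature.Topology.FourManifolds CategoryTheory.Limits

namespace Summit.SmoothPoincare4.SmoothPoincare4.Theorems.AcyclicBisectionRigidity.Negative

open Summit.SmoothPoincare4.SmoothPoincare4.Theses.ConvexBisection
open Summit.SmoothPoincare4.SmoothPoincare4.Theorems.ContractibleTwistedDoubleStandard.Negative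
  (double_standard_of_crux contractibleSpace_closedBall_four)

/-- **The crux implies the round-2 Transfer `DoubleReduction`, with `W = 𝔻⁴`.** Given
`AcyclicBisectionRigidity`, every homotopy 4-sphere `M` carrying an acyclic common-contact Stein
bisection is a DOUBLE of some compact contractible Stein domain — namely of the closed 4-ball: the
crux gives `M ≅ S⁴`, `S⁴ = 𝔻⁴ ∪_id 𝔻⁴` (`isDouble_sphere_holds 3`), and gluings transport along
diffeomorphisms of the glued manifold (`IsBoundaryGluing.diffeomorph_comp`); `𝔻⁴` is compact,
contractible (`contractibleSpace_closedBall_four`) and Stein (`steinStructureClosedBall`). So the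
Transfer is crux-implied: it is not a weakening of the crux's conclusion in any usable sense. [folklore] -/
theorem isDouble_closedBall_of_crux (h : AcyclicBisectionRigidity)
    (M : Type) [TopologicalSpace M] [T2Space M] [SecondCountableTopology M]
    [ChartedSpace (EuclideanSpace ℝ (Fin 4)) M] [IsManifold (𝓡 4) ∞ M]
    (hM : M ≃ₕ Metric.sphere (0 : EuclideanSpace ℝ (Fin 5)) 1)
    (hb : ∃ (W₁ : Type) (_ : TopologicalSpace W₁) (_ : ChartedSpace (EuclideanHalfSpace 4) W₁)
      (_ : IsManifold (𝓡∂ 4) ∞ W₁) (_ : CompactSpace W₁) (W₂ : Type) (_ : TopologicalSpace W₂)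
      (_ : ChartedSpace (EuclideanHalfSpace 4) W₂) (_ : IsManifold (𝓡∂ 4) ∞ W₂) (_ : CompactSpace W₂)
      (J₁ : SteinStructure W₁) (J₂ : SteinStructure W₂) (e₁ : W₁ → M) (e₂ : W₂ → M),
      Manifold.IsSmoothEmbedding (𝓡∂ 4) (𝓡 4) ∞ e₁ ∧ Manifold.IsSmoothEmbedding (𝓡∂ 4) (𝓡 4) ∞ e₂ ∧
      Set.range e₁ ∪ Set.range e₂ = Set.univ ∧
      Set.range e₁ ∩ Set.range e₂ = e₁ '' (𝓡∂ 4).boundary W₁ ∧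
      Set.range e₁ ∩ Set.range e₂ = e₂ '' (𝓡∂ 4).boundary W₂ ∧
      (∀ w₁ w₂, e₁ w₁ = e₂ w₂ →
        Submodule.map (mfderiv (𝓡∂ 4) (𝓡 4) e₁ w₁).toLinearMap (contactPlane J₁.J w₁) =
        Submodule.map (mfderiv (𝓡∂ 4) (𝓡 4) e₂ w₂).toLinearMap (contactPlane J₂.J w₂)) ∧
      (∀ k, 0 < k → IsZero (singularHomology ℚ ℚ W₁ k) ∧ IsZero (singularHomology ℚ ℚ W₂ k))) :
    ∃ (W : Type) (_ : TopologicalSpace W) (_ : ChartedSpace (EuclideanHalfSpace 4) W)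
      (_ : IsManifold (𝓡∂ 4) ∞ W) (_ : CompactSpace W) (_ : ContractibleSpace W) (_ : SteinStructure W)
      (b : BoundaryData (𝓡∂ 4) W (𝓡 3)), IsDouble b (𝓡 4) M := by
  obtain ⟨Ψ⟩ := h M hM hb
  haveI := contractibleSpace_closedBall_four
  refine ⟨Metric.closedBall (0 : EuclideanSpace ℝ (Fin 4)) 1, inferInstance, inferInstance, inferInstance,
    inferInstance, inferInstance, steinStructureClosedBall, closedBallBoundaryData 3, ?_⟩
  exact (isDouble_sphere_holds (n := 3)).isBoundaryGluing.diffeomorph_comp Ψ.symm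

/-- **Hence the Transfer `DoubleReduction` is SPC4-implied** (the crux is: every statement of the
shape `∀ M ≃ₕ S⁴, P M → M ≅ S⁴` follows from the summit). [folklore] -/
theorem isDouble_closedBall_of_spc4 (h : SmoothPoincare4)
    (M : Type) [TopologicalSpace M] [T2Space M] [SecondCountableTopology M]
    [ChartedSpace (EuclideanSpace ℝ (Fin 4)) M] [IsManifold (𝓡 4) ∞ M]
    (hM : M ≃ₕ Metric.sphere (0 : EuclideanSpace ℝ (Fin 5)) 1) :
    ∃ (W : Type) (_ : TopologicalSpace W) (_ : ChartedSpace (EuclideanHalfSpace 4) W)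
      (_ : IsManifold (𝓡∂ 4) ∞ W) (_ : CompactSpace W) (_ : ContractibleSpace W) (_ : SteinStructure W)
      (b : BoundaryData (𝓡∂ 4) W (𝓡 3)), IsDouble b (𝓡 4) M := by
  obtain ⟨Ψ⟩ := h M inferInstance inferInstance hM
  haveI := contractibleSpace_closedBall_four
  refine ⟨Metric.closedBall (0 : EuclideanSpace ℝ (Fin 4)) 1, inferInstance, inferInstance, inferInstance,
    inferInstance, inferInstance, steinStructureClosedBall, closedBallBoundaryData 3, ?_⟩
  exact (isDouble_sphere_holds (n := 3)).isBoundaryGluing.diffeomorph_comp Ψ.symm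

/-- **Modulo crux 4, the Transfer `DoubleReduction` IS the crux.** Given
`ContractibleTwistedDoubleStandard` (stmt-SmoothPoincare4-3546): `AcyclicBisectionRigidity` holds
iff every acyclically bisected homotopy 4-sphere is a double of some compact contractible Stein
domain (`→`: `isDouble_closedBall_of_crux`; `←`: such a double is `S⁴` by the sibling's
`double_standard_of_crux`). The card `achiral-relator-reduction`'s Transfer therefore gains nothing
as a STATEMENT; its content is the method by which it proposes to reach doubles. [folklore] -/
theorem crux_iff_doubleReduction_of_crux4 (h4 : ContractibleTwistedDoubleStandard) :
    AcyclicBisectionRigidity ↔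
    ∀ (M : Type) [TopologicalSpace M] [T2Space M] [SecondCountableTopology M]
      [ChartedSpace (EuclideanSpace ℝ (Fin 4)) M] [IsManifold (𝓡 4) ∞ M],
      M ≃ₕ Metric.sphere (0 : EuclideanSpace ℝ (Fin 5)) 1 →
      (∃ (W₁ : Type) (_ : TopologicalSpace W₁) (_ : ChartedSpace (EuclideanHalfSpace 4) W₁)
        (_ : IsManifold (𝓡∂ 4) ∞ W₁) (_ : CompactSpace W₁) (W₂ : Type) (_ : TopologicalSpace W₂)
        (_ : ChartedSpace (EuclideanHalfSpace 4) W₂) (_ : IsManifold (𝓡∂ 4) ∞ W₂) (_ : CompactSpace W₂)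
        (J₁ : SteinStructure W₁) (J₂ : SteinStructure W₂) (e₁ : W₁ → M) (e₂ : W₂ → M),
        Manifold.IsSmoothEmbedding (𝓡∂ 4) (𝓡 4) ∞ e₁ ∧ Manifold.IsSmoothEmbedding (𝓡∂ 4) (𝓡 4) ∞ e₂ ∧
        Set.range e₁ ∪ Set.range e₂ = Set.univ ∧
        Set.range e₁ ∩ Set.range e₂ = e₁ '' (𝓡∂ 4).boundary W₁ ∧
        Set.range e₁ ∩ Set.range e₂ = e₂ '' (𝓡∂ 4).boundary W₂ ∧
        (∀ w₁ w₂, e₁ w₁ = e₂ w₂ →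
          Submodule.map (mfderiv (𝓡∂ 4) (𝓡 4) e₁ w₁).toLinearMap (contactPlane J₁.J w₁) =
          Submodule.map (mfderiv (𝓡∂ 4) (𝓡 4) e₂ w₂).toLinearMap (contactPlane J₂.J w₂)) ∧
        (∀ k, 0 < k → IsZero (singularHomology ℚ ℚ W₁ k) ∧ IsZero (singularHomology ℚ ℚ W₂ k))) →
      ∃ (W : Type) (_ : TopologicalSpace W) (_ : ChartedSpace (EuclideanHalfSpace 4) W)
        (_ : IsManifold (𝓡∂ 4) ∞ W) (_ : CompactSpace W) (_ : ContractibleSpace W) (_ : SteinStructure W)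
        (b : BoundaryData (𝓡∂ 4) W (𝓡 3)), IsDouble b (𝓡 4) M := by
  refine ⟨fun h M _ _ _ _ _ hM hb => isDouble_closedBall_of_crux h M hM hb, fun hD M _ _ _ _ _ hM hb => ?_⟩
  obtain ⟨W, _, _, _, _, _, S, b, hdouble⟩ := hD M hM hb
  exact double_standard_of_crux h4 W S b M hdouble

/-- **The typed first lemma of card `exchange-recognition` (`ComplementRecognition`) is uniqueness of
gluings**: if `M` and `S⁴` are both the gluing `W₁ ∪_φ W₂` of two compact smooth 4-manifolds with
boundary along a DIFFEOMORPHISM `φ : ∂W₁ ≅ ∂W₂`, then `M ≅ S⁴` — the tree's theorem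
`nonempty_diffeomorph_of_isBoundaryGluing_holds` (Hirsch, *Differential Topology*, Ch. 8 Thm 2.1).
(The card types `φ` as a bare bijection of the boundary carriers; a seam identification is a
diffeomorphism, and the tree fact is stated for `≃ₘ`.) The lemma carries no content of its own: the
line's content is the exchange lemma of Kirby calculus, untyped in the tree. [cite: HirschDT1976, Ch. 8 §2, Thm. 2.1] -/
theorem complementRecognition
    (M : Type) [TopologicalSpace M] [ChartedSpace (EuclideanSpace ℝ (Fin 4)) M] [IsManifold (𝓡 4) ∞ M]
    (W₁ : Type) [TopologicalSpace W₁] [T2Space W₁] [SecondCountableTopology W₁]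
    [ChartedSpace (EuclideanHalfSpace 4) W₁] [IsManifold (𝓡∂ 4) ∞ W₁] [CompactSpace W₁]
    (W₂ : Type) [TopologicalSpace W₂] [T2Space W₂] [SecondCountableTopology W₂]
    [ChartedSpace (EuclideanHalfSpace 4) W₂] [IsManifold (𝓡∂ 4) ∞ W₂] [CompactSpace W₂]
    (b₁ : BoundaryData (𝓡∂ 4) W₁ (𝓡 3)) (b₂ : BoundaryData (𝓡∂ 4) W₂ (𝓡 3))
    (φ : b₁.carrier ≃ₘ⟮𝓡 3, 𝓡 3⟯ b₂.carrier)
    (hM : IsBoundaryGluing b₁ b₂ φ (𝓡 4) M)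
    (hS : IsBoundaryGluing b₁ b₂ φ (𝓡 4) (Metric.sphere (0 : EuclideanSpace ℝ (Fin 5)) 1)) :
    Nonempty (M ≃ₘ⟮𝓡 4, 𝓡 4⟯ Metric.sphere (0 : EuclideanSpace ℝ (Fin 5)) 1) :=
  nonempty_diffeomorph_of_isBoundaryGluing_holds hM hS

end Summit.SmoothPoincare4.SmoothPoincare4.Theorems.AcyclicBisectionRigidity.Negative
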